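import Summits.QuantumFields.YangMills.Theorems.FluctuationComparisonRegPrIntLS2BetaQuaternionReadFibreIdentity
import Summits.QuantumFields.YangMills.Theorems.FluctuationComparisonRegPrIntLS2BetaThresholdSum
import Summits.QuantumFields.YangMills.Theorems.FluctuationComparisonRegPrIntLS2BetaCritMQuaternionReadWindow
import HarnessLib

/-!
# S2β ∕ GAP♯∘ strata residue — THE PREFIX DOOR OF THE LAST LETTER: TAYLOR♭_q (hence AVG₂♭-ax_q) FROM A GUARD-EXPLICIT LOCAL SECOND-ORDER LETTER
# (the (C1)→(C2) split of the (RINV-curl) road, repeated for AVG₂♭-ax_q; T³ record; DEFINITION-FREE)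

Cell `ym3-torus` (YM ladder rung R3 = continuum `SU(2)` Yang–Mills on the three-torus — a RUNG: NOT d = 4, NOT infinite volume,
NOT a mass gap, NOT Clay).  Width seat «width 16» `ym3-torus-px16` (gen 22), FREE px helper on crux `stmt-QuantumFields-20520`
(`FluctuationComparisonRegPrIntL`), count-neutral, DEFINITION-FREE (0 `def`, 0 `instance`, 0 `notation`, 0 `sorry`), default heartbeats.

WHY.  By ✓p827199 ∕ ✓p827429 the pairing lane's registered stub GAP♯∘ is `{h3, (D-ax)×2, AVG₂♭-ax_q×2}` away; px17 g22's ✓`…QuaternionReadFibreIdentity.avg2_of_taylor`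
reduces AVG₂♭-ax_q (✓p825995's `hM`) to TAYLOR♭_q — both in the REGISTRY PREFIX (`∀ L ∃ c₀ … ∃ γ₁ ∃ C_T ∀ F γ … ∀ U₀ ∈ argmin`).  The analytic core (px10 g24, px13 g26
(β), px5 g23 Q7, px20 g23 counts, this seat's ✓p828102 ladder) is LOCAL: one good history, explicit dictionary guards, no `γ`, no argmin.  THIS FILE is the prefix plumbing
ONCE, so the core can target a guard-explicit local text and land by `exact`:
★★★ `taylor_of_local (G) (Ax) (hLoc)` : TAYLOR♭_q VERBATIM (= ✓`avg2_of_taylor`'s `hT`), where `hLoc` = «for every `L > 1` there are `C_T, c ≥ 0` such that for every member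
`F` (`F.L = L`), all `J ≤ K`, every threshold profile `θ ≥ 0` and `α` with the dictionary guard (`(5L)²∕4·θ_i ≤ α ≤ 1∕24` on `J < i ≤ K`, `α < δ_{SU(2)}`, `157α < L⁻²`),
every `U₀ ∈ histGood F ℰp θ K J`, every `ζ` with `‖ζ ℓ‖ ≤ π`, `expPoint ζ•U₀ ∈ histGood θ` and `Ax(expPoint ζ•U₀, U₀)`:
`Σ_B ‖Mq ζ B − DMq (sinc‖ζ‖•ζ) B‖ ≤ C_T·exp(c·Σ_{i<K−J}(5L)²∕4·θ(K−i))·((L⁻¹)^{K−J}Σ_ℓ‖ζ ℓ‖² + L^{K−J}Σ_p(1 − reTr(U₀(∂p)⁻¹·(expPoint ζ•U₀)(∂p))))`» — the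
history-weight `exp(c·Σθ)` of (D2)∕(H) is ALLOWED in the local constant and absorbed here by ✓`thresholdSum_small` (the sum is `≤ 1`, depth-free), the guard by
✓`prefixNumerics`; ★★★ `avg2_of_local (G) (Ax) (hLoc)` : AVG₂♭-ax_q (`hM`) VERBATIM (✓`avg2_of_taylor` ∘ `taylor_of_local`).
⇒ With ✓p827429: GAP♯∘ ⟸ {h3, (D-ax)×2, `hLoc` at the two stratum guards}.

HONEST SCOPE.  Prefix plumbing; `hLoc` is a HYPOTHESIS (the open analytic core); nothing of Bałaban's analysis is asserted; AVG₂♭-ax_q, (D-ax), GAP♯∘ (`stub_uniformFibreGapOrbit`;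
registry `Lines/semiclassical_s2beta.lean` 3732b7df UNTOUCHED), the five registered stubs, S2β, crux 20520, 19936, 19200 and `YM3TorusSU2` are NOT proved; no registered stub is
closed; the Yang–Mills mass gap is NOT proved.  Sorry-free, axioms standard.

References: T. Bałaban, CMP **98** (1985) 17–51 [Balaban1985Averaging] (Prop. 3 (123) p.36, (127)–(128) p.37, (148)–(149) p.40: the second-order remainder of the k-fold
averaging); CMP **102** (1985) 255–275 [Balaban1985UV3] ((3) p.256, (7) p.257); CMP **109** (1987) 249–301 [Balaban1987RG1] ((0.4) p.253).
-/

set_option autoImplicit false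

noncomputable section

open scoped Matrix.Norms.L2Operator Topology Quaternion
open Filter Set Function Finset
open Literature.MathematicalPhysics.QuantumLattice (su2Quat)
open Literature.MathematicalPhysics.QuantumFieldTheory.Balaban1983to89
open Literature.MathematicalPhysics.QuantumFieldTheory.Balaban1983to89.ExpMeanLog (expMeanLogSU deltaSU deltaSU_pos)
open Literature.MathematicalPhysics.QuantumFieldTheory.Balaban1983to89.T3ContinuumYM3Torus
open Literature.MathematicalPhysics.QuantumFieldTheory.Balaban1983to89.T3UnitLawDensityEML (ℰp)
open Literature.MathematicalPhysics.QuantumFieldTheory.Balaban1983to89.T3UnitScaleTilt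
open Literature.MathematicalPhysics.QuantumFieldTheory.Balaban1983to89.T3TiltDescent
open Literature.MathematicalPhysics.QuantumFieldTheory.Balaban1983to89.T3ConstrainedMinimiser (fibre)
open Literature.MathematicalPhysics.QuantumFieldTheory.Balaban1983to89.T3DescentFibreTower
open Literature.MathematicalPhysics.QuantumFieldTheory.Balaban1983to89.T3PrintedRegularMinimiser
open Literature.MathematicalPhysics.QuantumFieldTheory.Balaban1983to89.T3PrintedMinimiserExistence
open Literature.MathematicalPhysics.QuantumFieldTheory.Balaban1983to89.T4HaarSU2ExpChart (expPoint)
open Literature.MathematicalPhysics.QuantumFieldTheory.Balaban1983to89.T4ExpWindowSmallField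
open Literature.MathematicalPhysics.QuantumFieldTheory.Balaban1983to89.T4Continuum
open Summit.QuantumFields.YangMills.Theorems.FluctuationComparisonRegPrIntLS2BetaQuaternionReadFibreIdentity (avg2_of_taylor)
open Summit.QuantumFields.YangMills.Theorems.FluctuationComparisonRegPrIntLS2BetaThresholdSum (thresholdSum_small)
open Summit.QuantumFields.YangMills.Theorems.FluctuationComparisonRegPrIntLS2BetaCritMQuaternionReadWindow (prefixNumerics)

namespace Summit.QuantumFields.YangMills.Theorems.FluctuationComparisonRegPrIntLS2BetaTaylorOfLocal

set_option maxHeartbeats 400000 in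
/-- ★★★ **TAYLOR♭_q FROM THE GUARD-EXPLICIT LOCAL SECOND-ORDER LETTER** (`hLoc`, history weight `exp(c·Σθ)` allowed): the prefix is discharged by ✓`prefixNumerics` (guard)
and ✓`thresholdSum_small` (`Σ_{i<K−J}(5L)²∕4·θBal(K−i) ≤ 1`, depth-free); `C_T′ := C_T·e^c`. [cite: Balaban1985Averaging, Prop. 3 (123) p.36, (148)-(149) p.40; Balaban1985UV3, (7) p.257; Balaban1987RG1, (0.4) p.253] -/
theorem taylor_of_local
    (G : (F : T3Family) → (J : ℕ) → GaugeField (F.P J) 0 (Matrix.specialUnitaryGroup (Fin 2) ℂ) → Prop)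
    (Ax : (F : T3Family) → (J K : ℕ) → (hJK : J ≤ K) → GaugeField (F.P K) 0 (Matrix.specialUnitaryGroup (Fin 2) ℂ) →
      GaugeField (F.P K) 0 (Matrix.specialUnitaryGroup (Fin 2) ℂ) → Prop)
    (hLoc : ∀ (L : ℕ), 1 < L → ∃ C_T : ℝ, 0 ≤ C_T ∧ ∃ c : ℝ, 0 ≤ c ∧ ∀ (F : T3Family), F.L = L →
      ∀ (J K : ℕ) (hJK : J ≤ K) (θ : ℕ → ℝ), (∀ i, 0 ≤ θ i) → ∀ (α : ℝ), (∀ i, J < i → i ≤ K → (((5 * F.L : ℕ) : ℝ) ^ 2 / 4) * θ i ≤ α) →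
        α ≤ 1 / 24 → α < deltaSU (Fin 2) → 157 * α < ((F.L : ℝ) ^ 2)⁻¹ →
        ∀ U₀ : GaugeField (F.P K) 0 (Matrix.specialUnitaryGroup (Fin 2) ℂ), U₀ ∈ histGood F ℰp θ K J →
        ∀ ζ : PBond (F.P K) 0 → EuclideanSpace ℝ (Fin 3), (∀ ℓ, ‖ζ ℓ‖ ≤ Real.pi) →
          (fun ℓ => expPoint (ζ ℓ) * U₀ ℓ : GaugeField (F.P K) 0 (Matrix.specialUnitaryGroup (Fin 2) ℂ)) ∈ histGood F ℰp θ K J →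
            Ax F J K hJK (fun ℓ => expPoint (ζ ℓ) * U₀ ℓ) U₀ →
            ∑ B : PBond (F.P J) 0, ‖imVec (su2Quat (descendTo F ℰp J K hJK (fun ℓ => expPoint (ζ ℓ) * U₀ ℓ) B * (descendTo F ℰp J K hJK U₀ B)⁻¹)) -
                (fderiv ℝ (fun (ζ : PBond (F.P K) 0 → EuclideanSpace ℝ (Fin 3)) (B : PBond (F.P J) 0) =>
                  imVec (su2Quat (descendTo F ℰp J K hJK (fun ℓ => expPoint (ζ ℓ) * U₀ ℓ) B * (descendTo F ℰp J K hJK U₀ B)⁻¹))) 0)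
                  (fun ℓ => Real.sinc ‖ζ ℓ‖ • ζ ℓ) B‖ ≤
              C_T * Real.exp (c * ∑ i ∈ Finset.range (K - J), (((5 * F.L : ℕ) : ℝ) ^ 2 / 4) * θ (K - i)) * (((F.L : ℝ)⁻¹) ^ (K - J) * ∑ ℓ : PBond (F.P K) 0, ‖ζ ℓ‖ ^ 2 +
                (F.L : ℝ) ^ (K - J) * ∑ p : Plaq (F.P K) 0,
                  (1 - reTr ((GaugeField.plaqHol U₀ p)⁻¹ * GaugeField.plaqHol (fun ℓ => expPoint (ζ ℓ) * U₀ ℓ : GaugeField (F.P K) 0 (Matrix.specialUnitaryGroup (Fin 2) ℂ)) p)))) :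
    ∀ (L : ℕ), ∃ c₀ : ℝ, 0 < c₀ ∧ c₀ ≤ 1 ∧ ∀ (cw : ℝ), 0 < cw → cw ≤ c₀ → ∃ pS : ℝ, ∀ (b₀ p₀ : ℝ), 0 < b₀ → pS ≤ p₀ → 0 < p₀ → ∃ ε₁ : ℝ, 0 < ε₁ ∧ ∀ (ε₀ : ℝ), 0 < ε₀ → ε₀ ≤ ε₁ →
    ∃ γ₁ : ℝ, 0 < γ₁ ∧ ∃ C_T : ℝ, 0 ≤ C_T ∧ ∀ (F : T3Family) (γ : ℝ), F.L = L → 0 < γ → γ ≤ γ₁ →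
      ∀ (J K : ℕ) (hJK : J ≤ K) (V : GaugeField (F.P J) 0 (Matrix.specialUnitaryGroup (Fin 2) ℂ)), PlaqSmall (θBal F.L γ (cw * b₀) p₀ J) V →
        G F J V →
        ∀ U₀ ∈ {U' : GaugeField (F.P K) 0 (Matrix.specialUnitaryGroup (Fin 2) ℂ) | U' ∈ fibre F ℰp J K hJK V ∧ U' ∈ histGood F ℰp (θBal F.L γ b₀ p₀) K J ∧
            wilsonAction4 U' = minActionRegPr F J K hJK ε₀ V},
        ∀ ζ : PBond (F.P K) 0 → EuclideanSpace ℝ (Fin 3), (∀ ℓ, ‖ζ ℓ‖ ≤ Real.pi) →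
          (fun ℓ => expPoint (ζ ℓ) * U₀ ℓ : GaugeField (F.P K) 0 (Matrix.specialUnitaryGroup (Fin 2) ℂ)) ∈ histGood F ℰp (θBal F.L γ b₀ p₀) K J →
            Ax F J K hJK (fun ℓ => expPoint (ζ ℓ) * U₀ ℓ) U₀ →
            ∑ B : PBond (F.P J) 0, ‖imVec (su2Quat (descendTo F ℰp J K hJK (fun ℓ => expPoint (ζ ℓ) * U₀ ℓ) B * (descendTo F ℰp J K hJK U₀ B)⁻¹)) -
                (fderiv ℝ (fun (ζ : PBond (F.P K) 0 → EuclideanSpace ℝ (Fin 3)) (B : PBond (F.P J) 0) =>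
                  imVec (su2Quat (descendTo F ℰp J K hJK (fun ℓ => expPoint (ζ ℓ) * U₀ ℓ) B * (descendTo F ℰp J K hJK U₀ B)⁻¹))) 0)
                  (fun ℓ => Real.sinc ‖ζ ℓ‖ • ζ ℓ) B‖ ≤
              C_T * (((F.L : ℝ)⁻¹) ^ (K - J) * ∑ ℓ : PBond (F.P K) 0, ‖ζ ℓ‖ ^ 2 +
                (F.L : ℝ) ^ (K - J) * ∑ p : Plaq (F.P K) 0,
                  (1 - reTr ((GaugeField.plaqHol U₀ p)⁻¹ * GaugeField.plaqHol (fun ℓ => expPoint (ζ ℓ) * U₀ ℓ : GaugeField (F.P K) 0 (Matrix.specialUnitaryGroup (Fin 2) ℂ)) p))) := by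
  intro L
  refine ⟨1, one_pos, le_rfl, fun cw hcw hcwle => ⟨0, fun b₀ p₀ hb hpS hp => ⟨1, one_pos, fun ε₀ hε₀ hε₀le => ?_⟩⟩⟩
  by_cases hL : 1 < L
  swap
  · refine ⟨1, one_pos, 0, le_rfl, fun F γ hFL => ?_⟩
    exact absurd (hFL ▸ F.hL.2) hL
  obtain ⟨C_T, hCT, c, hc, HL⟩ := hLoc L hL
  obtain ⟨γN, hγN, α, HN⟩ := prefixNumerics (L := L) hL (a₁ := 1) (B₃ := 1) (ε₀ := 1) one_pos one_pos one_pos hb p₀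
  set q : ℝ := (((5 * L : ℕ) : ℝ) ^ 2 / 4) with hq
  have hq0 : 0 ≤ q := by positivity
  obtain ⟨γS, hγS, HS⟩ := thresholdSum_small L hL b₀ p₀ hb hp q 1 1 hq0 one_pos one_pos
  refine ⟨min γN γS, lt_min hγN hγS, C_T * Real.exp c, by positivity, ?_⟩
  intro F γ hFL hγ hγle J K hJK V hV hG U₀ hU₀ ζ hζπ hζg hAx
  have hγN' : γ ≤ γN := hγle.trans (min_le_left _ _)
  have hγS' : γ ≤ γS := hγle.trans (min_le_right _ _)
  obtain ⟨hθpos, -, -, -, hθα, hα24, hαδ, hαL⟩ := HN F γ hFL hγ hγN'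
  obtain ⟨-, hsum⟩ := HS γ hγ hγS'
  have hθ0 : ∀ i, 0 ≤ θBal F.L γ b₀ p₀ i := fun i => (hθpos i).le
  have hθα' : ∀ i, J < i → i ≤ K → (((5 * F.L : ℕ) : ℝ) ^ 2 / 4) * θBal F.L γ b₀ p₀ i ≤ α := fun i _ _ => hθα i
  have hloc := HL F hFL J K hJK (θBal F.L γ b₀ p₀) hθ0 α hθα' hα24 hαδ hαL U₀ hU₀.2.1 ζ hζπ hζg hAx
  refine hloc.trans ?_
  have hsum1 : ∑ i ∈ Finset.range (K - J), (((5 * F.L : ℕ) : ℝ) ^ 2 / 4) * θBal F.L γ b₀ p₀ (K - i) ≤ 1 := by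
    have h := hsum J K hJK
    rw [← Finset.mul_sum]
    rw [hFL]; exact (by simpa only [hq, one_mul] using h)
  have hexp : Real.exp (c * ∑ i ∈ Finset.range (K - J), (((5 * F.L : ℕ) : ℝ) ^ 2 / 4) * θBal F.L γ b₀ p₀ (K - i)) ≤ Real.exp c := by
    refine Real.exp_le_exp.2 ?_
    calc c * _ ≤ c * 1 := mul_le_mul_of_nonneg_left hsum1 hc
      _ = c := mul_one c
  have hR : 0 ≤ (((F.L : ℝ)⁻¹) ^ (K - J) * ∑ ℓ : PBond (F.P K) 0, ‖ζ ℓ‖ ^ 2 +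
                (F.L : ℝ) ^ (K - J) * ∑ p : Plaq (F.P K) 0,
                  (1 - reTr ((GaugeField.plaqHol U₀ p)⁻¹ * GaugeField.plaqHol (fun ℓ => expPoint (ζ ℓ) * U₀ ℓ : GaugeField (F.P K) 0 (Matrix.specialUnitaryGroup (Fin 2) ℂ)) p))) := by
    refine add_nonneg (by positivity) (mul_nonneg (by positivity) (Finset.sum_nonneg fun p _ => ?_))
    have := GaugeGroup.reTr_le_one ((GaugeField.plaqHol U₀ p)⁻¹ *
      GaugeField.plaqHol (fun ℓ => expPoint (ζ ℓ) * U₀ ℓ : GaugeField (F.P K) 0 (Matrix.specialUnitaryGroup (Fin 2) ℂ)) p)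
    linarith
  calc C_T * Real.exp (c * ∑ i ∈ Finset.range (K - J), (((5 * F.L : ℕ) : ℝ) ^ 2 / 4) * θBal F.L γ b₀ p₀ (K - i)) * (((F.L : ℝ)⁻¹) ^ (K - J) * ∑ ℓ : PBond (F.P K) 0, ‖ζ ℓ‖ ^ 2 +
                (F.L : ℝ) ^ (K - J) * ∑ p : Plaq (F.P K) 0,
                  (1 - reTr ((GaugeField.plaqHol U₀ p)⁻¹ * GaugeField.plaqHol (fun ℓ => expPoint (ζ ℓ) * U₀ ℓ : GaugeField (F.P K) 0 (Matrix.specialUnitaryGroup (Fin 2) ℂ)) p)))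
      ≤ C_T * Real.exp c * (((F.L : ℝ)⁻¹) ^ (K - J) * ∑ ℓ : PBond (F.P K) 0, ‖ζ ℓ‖ ^ 2 +
                (F.L : ℝ) ^ (K - J) * ∑ p : Plaq (F.P K) 0,
                  (1 - reTr ((GaugeField.plaqHol U₀ p)⁻¹ * GaugeField.plaqHol (fun ℓ => expPoint (ζ ℓ) * U₀ ℓ : GaugeField (F.P K) 0 (Matrix.specialUnitaryGroup (Fin 2) ℂ)) p))) := by gcongr

/-- ★★★ **AVG₂♭-ax_q (✓p825995's `hM`, VERBATIM) FROM THE LOCAL LETTER** (px17 g22's ✓`avg2_of_taylor` ∘ `taylor_of_local`). With ✓p827429 `uniformFibreGapOrbit_of_letters`: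
GAP♯∘ ⟸ {h3, (D-ax)×2, `hLoc` at the two stratum guards}. [cite: Balaban1985Averaging, Prop. 3 (123) p.36, (148)-(149) p.40; Balaban1985UV3, (7) p.257] -/
theorem avg2_of_local
    (G : (F : T3Family) → (J : ℕ) → GaugeField (F.P J) 0 (Matrix.specialUnitaryGroup (Fin 2) ℂ) → Prop)
    (Ax : (F : T3Family) → (J K : ℕ) → (hJK : J ≤ K) → GaugeField (F.P K) 0 (Matrix.specialUnitaryGroup (Fin 2) ℂ) →
      GaugeField (F.P K) 0 (Matrix.specialUnitaryGroup (Fin 2) ℂ) → Prop)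
    (hLoc : ∀ (L : ℕ), 1 < L → ∃ C_T : ℝ, 0 ≤ C_T ∧ ∃ c : ℝ, 0 ≤ c ∧ ∀ (F : T3Family), F.L = L →
      ∀ (J K : ℕ) (hJK : J ≤ K) (θ : ℕ → ℝ), (∀ i, 0 ≤ θ i) → ∀ (α : ℝ), (∀ i, J < i → i ≤ K → (((5 * F.L : ℕ) : ℝ) ^ 2 / 4) * θ i ≤ α) →
        α ≤ 1 / 24 → α < deltaSU (Fin 2) → 157 * α < ((F.L : ℝ) ^ 2)⁻¹ →
        ∀ U₀ : GaugeField (F.P K) 0 (Matrix.specialUnitaryGroup (Fin 2) ℂ), U₀ ∈ histGood F ℰp θ K J →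
        ∀ ζ : PBond (F.P K) 0 → EuclideanSpace ℝ (Fin 3), (∀ ℓ, ‖ζ ℓ‖ ≤ Real.pi) →
          (fun ℓ => expPoint (ζ ℓ) * U₀ ℓ : GaugeField (F.P K) 0 (Matrix.specialUnitaryGroup (Fin 2) ℂ)) ∈ histGood F ℰp θ K J →
            Ax F J K hJK (fun ℓ => expPoint (ζ ℓ) * U₀ ℓ) U₀ →
            ∑ B : PBond (F.P J) 0, ‖imVec (su2Quat (descendTo F ℰp J K hJK (fun ℓ => expPoint (ζ ℓ) * U₀ ℓ) B * (descendTo F ℰp J K hJK U₀ B)⁻¹)) -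
                (fderiv ℝ (fun (ζ : PBond (F.P K) 0 → EuclideanSpace ℝ (Fin 3)) (B : PBond (F.P J) 0) =>
                  imVec (su2Quat (descendTo F ℰp J K hJK (fun ℓ => expPoint (ζ ℓ) * U₀ ℓ) B * (descendTo F ℰp J K hJK U₀ B)⁻¹))) 0)
                  (fun ℓ => Real.sinc ‖ζ ℓ‖ • ζ ℓ) B‖ ≤
              C_T * Real.exp (c * ∑ i ∈ Finset.range (K - J), (((5 * F.L : ℕ) : ℝ) ^ 2 / 4) * θ (K - i)) * (((F.L : ℝ)⁻¹) ^ (K - J) * ∑ ℓ : PBond (F.P K) 0, ‖ζ ℓ‖ ^ 2 +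
                (F.L : ℝ) ^ (K - J) * ∑ p : Plaq (F.P K) 0,
                  (1 - reTr ((GaugeField.plaqHol U₀ p)⁻¹ * GaugeField.plaqHol (fun ℓ => expPoint (ζ ℓ) * U₀ ℓ : GaugeField (F.P K) 0 (Matrix.specialUnitaryGroup (Fin 2) ℂ)) p)))) :
    ∀ (L : ℕ), ∃ c₀ : ℝ, 0 < c₀ ∧ c₀ ≤ 1 ∧ ∀ (cw : ℝ), 0 < cw → cw ≤ c₀ → ∃ pS : ℝ, ∀ (b₀ p₀ : ℝ), 0 < b₀ → pS ≤ p₀ → 0 < p₀ → ∃ ε₁ : ℝ, 0 < ε₁ ∧ ∀ (ε₀ : ℝ), 0 < ε₀ → ε₀ ≤ ε₁ →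
    ∃ γ₁ : ℝ, 0 < γ₁ ∧ ∃ C_M : ℝ, 0 ≤ C_M ∧ ∀ (F : T3Family) (γ : ℝ), F.L = L → 0 < γ → γ ≤ γ₁ →
      ∀ (J K : ℕ) (hJK : J ≤ K) (V : GaugeField (F.P J) 0 (Matrix.specialUnitaryGroup (Fin 2) ℂ)), PlaqSmall (θBal F.L γ (cw * b₀) p₀ J) V →
        G F J V →
        ∀ U₀ ∈ {U' : GaugeField (F.P K) 0 (Matrix.specialUnitaryGroup (Fin 2) ℂ) | U' ∈ fibre F ℰp J K hJK V ∧ U' ∈ histGood F ℰp (θBal F.L γ b₀ p₀) K J ∧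
            wilsonAction4 U' = minActionRegPr F J K hJK ε₀ V},
        ∀ U ∈ fibre F ℰp J K hJK V, U ∈ histGood F ℰp (θBal F.L γ b₀ p₀) K J →
            Ax F J K hJK U U₀ →
            ∑ B : PBond (F.P J) 0, ‖(fderiv ℝ (fun (ζ : PBond (F.P K) 0 → EuclideanSpace ℝ (Fin 3)) (B : PBond (F.P J) 0) =>
            imVec (su2Quat (descendTo F ℰp J K hJK (fun ℓ => expPoint (ζ ℓ) * U₀ ℓ) B * (descendTo F ℰp J K hJK U₀ B)⁻¹))) 0) (fun ℓ => imVec (su2Quat (U ℓ * (U₀ ℓ)⁻¹))) B‖ ≤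
              C_M * (((F.L : ℝ)⁻¹) ^ (K - J) * ∑ ℓ : PBond (F.P K) 0, dist1 (U ℓ * (U₀ ℓ)⁻¹) ^ 2 +
                (F.L : ℝ) ^ (K - J) * ∑ p : Plaq (F.P K) 0, (1 - reTr ((GaugeField.plaqHol U₀ p)⁻¹ * GaugeField.plaqHol U p))) :=
  avg2_of_taylor G Ax (taylor_of_local G Ax hLoc)

end Summit.QuantumFields.YangMills.Theorems.FluctuationComparisonRegPrIntLS2BetaTaylorOfLocal

end
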